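import Summits.QuantumFields.BalabanUV.T4Continuum.Support.NE7NearStabiliser
import HarnessLib

/-!
# NE7NearStabiliserTorus — NEAR-STABILISERS OF A PERIODIC LATTICE GAUGE DATUM ARE NEAR ITS STABILISER, AT A LINEAR RATE (the torus form of `NE7NearStabiliser`): for a unitary
# `N`-periodic datum `V₀` on `ℤ^d` there is `C = C(V₀, N)` such that every unitary `N`-periodic site field `g` admits a unitary `N`-periodic `s` FIXING `V₀` (`s·V₀ = V₀`) with
# `‖g(z) − s(z)‖ ≤ C·η` as soon as `g` moves `V₀` by at most `η` bondwise (`‖V₀(b)⁻¹(g·V₀)(b) − 1‖ ≤ η` on the period box) — the orbit-geometry letter that closes the «optimal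
# gauge» loop of gen 114's LIPSCHITZ dependence of the constrained minimiser `U_k(V)` on `V`

Cell `pub-balaban`, rung (B)+1 sub-cell t4, lineage `b2b-balaban-t4-ne7-p1` (CRUX PROVER NE7 #1 = OWNER of BINDER row NE7), generation 114.  Memo
`t4/b2b-balaban-t4-ne7-p1-g114/ROAD-G114.md` §3.  The core `NE7NearStabiliser.near_stabiliser_core` at the bond structure of the period box: sites `[0,N)^d`, bond labels `κ`,
neighbour `z + e_κ mod N` (`redN`), bond values `V₀(boxVec r, κ)`; then periodic extension along `redN` (`redN_add_smul`, `eq_wrap_add`, `periodic_smul_vec`).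
WHAT ([folklore]; 0 def, 0 sorry; any `d`, any `U(n)`).  `site_eq_wrap`; **`near_stabiliser`** (statement in the theorem's docstring).
HONEST FRAMING (page 1): elementary; `C` EXISTENTIAL (depends on `V₀`, `N`, `n`), no rate in `N`; nothing of Bałaban's asserted; NOT NE7, NOT NE3; spine 0∕9; finite T⁴ rung (B)+1 —
NOT infinite volume, NOT mass gap, NOT BetaPertH, NOT Clay (continuum YM on T⁴ ⇐ BetaPertH ∧ nine spine estimates).
-/

set_option autoImplicit false

open scoped BigOperators Matrix Matrix.Norms.L2Operator Topology NNReal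
open NormedSpace Set Filter Metric

namespace Summit.QuantumFields.BalabanUV.T4Continuum.NE7NearStabiliserTorus

open Literature.MathematicalPhysics.QuantumFieldTheory.Balaban1983to89
open B7Prop1Explicit B7Prop2Explicit MatrixLog UnitaryModel
open T4AveragingDeficitWall (IsUnitaryCfg)
open T4AveragingDeficitWallBoundary (IsPeriodicCfg)
open AveragingDeficitTorusChart (redN boxVec_redN redN_boxVec redN_add_smul eq_wrap_add periodic_smul_vec)
open NE3EnergyShapes (IsUnitarySite IsPeriodicSite)
open NE7DatumCoordinateStabiliser (inv_mem_unitary)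
open NE7NearStabiliser (near_stabiliser_core)

noncomputable section

variable {n : Type*} [Fintype n] [DecidableEq n]

/-! ## The torus: near-stabilisers of a periodic datum -/

variable {d : ℕ}

/-- A periodic site field only depends on the wrap of the site. [folklore] -/
theorem site_eq_wrap {α : Type*} {N : ℕ} [NeZero N] {u : Site d → α} (hu : ∀ (x : Site d) (i : Fin d), u (x + (N : ℤ) • e i) = u x) (z : Site d) :
    u z = u (boxVec N (redN N z)) := by
  conv_lhs => rw [eq_wrap_add N z]
  exact periodic_smul_vec hu _ _

set_option maxHeartbeats 800000 in
/-- **NEAR-STABILISERS OF A LATTICE GAUGE DATUM ARE NEAR ITS STABILISER, AT A LINEAR RATE.**  `V₀` a unitary `N`-periodic configuration on `ℤ^d`.  THEN `∃ C ≥ 0` (a function of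
`V₀`, `N`, `n`) such that for every unitary `N`-periodic site field `g` and every `η ≥ 0` with `‖V₀(b)⁻¹·(g·V₀)(b) − 1‖ ≤ η` at every bond `b` of the period box, there is a unitary
`N`-periodic site field `s` with `s·V₀ = V₀` (`gaugeAct s V₀ = V₀`) and `‖g(z) − s(z)‖ ≤ C·η` at every site. [folklore] -/
theorem near_stabiliser [Nonempty n] {N : ℕ} [NeZero N] {V₀ : Site d → Fin d → (Matrix n n ℂ)ˣ} (hV₀u : IsUnitaryCfg V₀) (hV₀P : IsPeriodicCfg V₀ (N : ℤ)) :
    ∃ C : ℝ, 0 ≤ C ∧ ∀ g : Site d → (Matrix n n ℂ)ˣ, IsUnitarySite g → IsPeriodicSite g (N : ℤ) → ∀ η : ℝ, 0 ≤ η →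
      (∀ (r : Fin d → Fin N) (κ : Fin d),
        ‖(((V₀ (boxVec N r) κ)⁻¹ : (Matrix n n ℂ)ˣ) : Matrix n n ℂ) * ((gaugeAct g V₀ (boxVec N r) κ : (Matrix n n ℂ)ˣ) : Matrix n n ℂ) - 1‖ ≤ η) →
      ∃ s : Site d → (Matrix n n ℂ)ˣ, IsUnitarySite s ∧ IsPeriodicSite s (N : ℤ) ∧ gaugeAct s V₀ = V₀ ∧
        ∀ z : Site d, ‖(g z : Matrix n n ℂ) - (s z : Matrix n n ℂ)‖ ≤ C * η := by
  letI : CStarAlgebra (Matrix n n ℂ) := {}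
  -- the finite bond structure of the period box
  set nb : (Fin d → Fin N) → Fin d → (Fin d → Fin N) := fun r κ => redN N (boxVec N r + e κ) with hnb
  set Vb : (Fin d → Fin N) → Fin d → Matrix n n ℂ := fun r κ => (V₀ (boxVec N r) κ : Matrix n n ℂ) with hVb
  have hVbu : ∀ r κ, Vb r κ ∈ unitary (Matrix n n ℂ) := fun r κ => mem_unitaryUnits.mp (hV₀u _ _)
  obtain ⟨C, hC, hcore⟩ := near_stabiliser_core (n := n) nb Vb hVbu
  refine ⟨C, hC, fun g hgu hgP η hη hdef => ?_⟩
  -- periodicity: the neighbour across the box boundary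
  have hV₀w : ∀ (z : Site d) (κ : Fin d), V₀ z κ = V₀ (boxVec N (redN N z)) κ := fun z κ =>
    site_eq_wrap (u := fun y => V₀ y κ) (fun y i => hV₀P y i κ) z
  have hgw : ∀ z : Site d, g z = g (boxVec N (redN N z)) := fun z => site_eq_wrap hgP z
  -- the box field of `g` and its defect
  set gb : (Fin d → Fin N) → Matrix n n ℂ := fun r => (g (boxVec N r) : Matrix n n ℂ) with hgb
  have hgbu : ∀ r, gb r ∈ unitary (Matrix n n ℂ) := fun r => mem_unitaryUnits.mp (hgu _)
  have hdefb : ∀ r κ, ‖gb r * Vb r κ - Vb r κ * gb (nb r κ)‖ ≤ η := by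
    intro r κ
    set x : Site d := boxVec N r with hx
    have hg' : g (x + e κ) = g (boxVec N (nb r κ)) := by rw [hnb]; exact hgw (x + e κ)
    -- `‖V⁻¹(gVg′⁻¹) − 1‖ = ‖gV − Vg′‖`
    have hval : (((V₀ x κ)⁻¹ : (Matrix n n ℂ)ˣ) : Matrix n n ℂ) * ((gaugeAct g V₀ x κ : (Matrix n n ℂ)ˣ) : Matrix n n ℂ) - 1
        = (((V₀ x κ)⁻¹ : (Matrix n n ℂ)ˣ) : Matrix n n ℂ) * ((g x : Matrix n n ℂ) * (V₀ x κ : Matrix n n ℂ) - (V₀ x κ : Matrix n n ℂ) * (g (x + e κ) : Matrix n n ℂ))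
          * (((g (x + e κ))⁻¹ : (Matrix n n ℂ)ˣ) : Matrix n n ℂ) := by
      simp only [gaugeAct, Units.val_mul, mul_sub, sub_mul]
      congr 1
      · simp only [mul_assoc]
      · rw [← mul_assoc, Units.inv_mul, one_mul, Units.mul_inv]
    have h1 := hdef r κ
    rw [← hx, hval, CStarRing.norm_mul_mem_unitary _ (inv_mem_unitary (hgu _)), CStarRing.norm_mem_unitary_mul _ (inv_mem_unitary (hV₀u _ _))] at h1
    rw [hgb, hVb]
    simp only
    rw [← hg', ← hx]
    exact h1
  obtain ⟨s, hsu, hsK, hsn⟩ := hcore gb hgbu η hη hdefb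
  -- periodic extension of `s`
  set sS : Site d → (Matrix n n ℂ)ˣ := fun z => Unitary.toUnits ⟨s (redN N z), hsu _⟩ with hsS
  have hsSval : ∀ z, (sS z : Matrix n n ℂ) = s (redN N z) := fun z => rfl
  refine ⟨sS, fun z => mem_unitaryUnits.mpr (by rw [hsSval]; exact hsu _), fun z i => ?_, ?_, fun z => ?_⟩
  · -- periodicity
    apply Units.ext
    rw [hsSval, hsSval, redN_add_smul]
  · -- `s·V₀ = V₀`
    funext z κ
    have hper : redN N (z + e κ) = nb (redN N z) κ := by
      rw [hnb]
      conv_lhs => rw [eq_wrap_add N z, add_right_comm]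
      exact redN_add_smul N _ _
    have hkey : (sS z : Matrix n n ℂ) * (V₀ z κ : Matrix n n ℂ) = (V₀ z κ : Matrix n n ℂ) * (sS (z + e κ) : Matrix n n ℂ) := by
      rw [hsSval, hsSval, hV₀w z κ, hper]
      exact hsK (redN N z) κ
    show sS z * V₀ z κ * (sS (z + e κ))⁻¹ = V₀ z κ
    have hu : sS z * V₀ z κ = V₀ z κ * sS (z + e κ) := Units.ext (by simpa only [Units.val_mul] using hkey)
    rw [hu, mul_inv_cancel_right]
  · -- the bound
    rw [hsSval, hgw z]
    exact hsn (redN N z)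

end

end Summit.QuantumFields.BalabanUV.T4Continuum.NE7NearStabiliserTorus
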